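import Mathlib
import HarnessLib
import HarnessLib.Audit
import Summits.Parity.Statement

/-!
Route: CompositionCertificates

CLOSED (retired) 2026-08-15T13:49:26Z by operator:999:1257524 — reason: not-a-thesis: assembly does not conclude the sub-problem Statement — note: D-0027 §2.1 audit (human 2026-08-15: routes that do not decide the summit are removed): the assembly concludes `OneBitChowlaQuadratic`, not the sub-problem statement; a NEW conforming route may be opened from the same idea (generated `closes : … → _root_.BatemanHorn`).. The file is kept as the record of this route; refuted decls are indexed as negative knowledge (`ledger negatives`).

# Route CompositionCertificates — Gauss composition certificates along n²+1 — one-bit Chowla, both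
signs, quantitative (THEOREM+PROBE route; X does not imply BatemanHorn)

THEOREM + PROBE ROUTE, declared up front (like GeneralizedHardyLittlewood/TargetGraphParity): X does
NOT imply the conjunct BatemanHorn nor
Literature.NumberTheory.Sieve.HardyLittlewoodConjE and is not claimed to; the Assembly concludes in
the Target. Realises card
composition-triples-one-bit-chowla (spine). Engine: for f = X²+bX+c and every factorisation f(n) =
k·k′ the Gauss-composition identity
f(n+k)·f(n+k′) = f(n)·(2n+k+k′+b)² (k = 1 is BorweinChoiGanguli2013; over ℤ[i] it is (n+i)(n+k−i) =
k(n+k′+i), i.e. the Stern–Brocot moves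
γ ↦ γT, γTᵗ on SL₂(ℤ) read through route UnimodularColumns' LagrangeDictionary) forces
g(f(n))·g(f(n+k))·g(f(n+k′)) = +1 for EVERY completely
multiplicative g : ℕ → {±1}: each divisor of n²+1 is a parity CERTIFICATE, and the ≍ X certificates
inside [1,X] form a 3-uniform hypergraph
whose transversals contain the +-set of every fake Liouville. It suffices to show X =
OneBitChowlaQuadratic = P ∧ M ∧ Q:
(P) some c > 0, X₀ serve ALL completely multiplicative ±1-valued g: #{n ≤ X : g(n²+1) = +1} ≥
c·X/log X (X ≥ X₀) — obtained in the Assembly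
from crux BalancedPairMoment (second moment of certificate degrees ≪ X log X) by Cauchy–Schwarz; (M)
#{n ≤ X : λ(n²+1) = −1} ≥ X^c for
some c > 0 (crux MinusPowerGrowth; the −1 side is λ-specific: Pell seeds n²+1 = 2y² branch along the
composition tree); (Q) λ(n²+bn+c) = −1
infinitely often for every irreducible monic quadratic (crux MinusEveryQuadratic: the case
Srinivasan2022's genus method excludes). The
unconditional rungs (composition law, sign law, ≍X certificates, X^{1−ε} plus-floor, a +1 in every
[Y,5Y], ≫ log X minus signs, τ/2-branching
of minus signs) are filed as supports: they are the card's theorems T1–T3 and the route's guaranteed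
deliverables (Theorems files).
Lean: `(∃ c : ℝ, 0 < c ∧ ∃ X₀ : ℕ, ∀ g : ℕ → ℤ, (∀ m n : ℕ, 0 < m → 0 < n → g (m * n) = g m * g n) →
(∀ n : ℕ, 0 < n → (g n = 1 ∨ g n = -1)) → ∀ X : ℕ, X₀ ≤ X → c * (X : ℝ) / Real.log (X : ℝ) ≤
(((Finset.Icc 1 X).filter (fun n : ℕ => g (n ^ 2 + 1) = 1)).card : ℝ)) ∧ (∃ c : ℝ, 0 < c ∧ ∃ X₀ : ℕ,
∀ X : ℕ, X₀ ≤ X → (X : ℝ) ^ c ≤ (((Finset.Icc 1 X).filter (fun n : ℕ => ArithmeticFunction.liouville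
(n ^ 2 + 1) = -1)).card : ℝ)) ∧ (∀ b c : ℤ, ¬ IsSquare (b ^ 2 - 4 * c) → Set.Infinite {n : ℕ |
ArithmeticFunction.liouville (((n : ℤ) ^ 2 + b * n + c).toNat) = -1})`

## Assembly
THEOREM+PROBE ROUTE: the conclusion is the Target OneBitChowlaQuadratic, not BatemanHorn. Glue
(provable, size M): conjuncts (M) and (Q)
are the hypotheses MinusPowerGrowth and MinusEveryQuadratic verbatim; (P) follows from
BalancedPairMoment, TripleCount, TripleSign: with
P_g = {v ≤ X : g(v²+1) = 1}, every pair (ν,d) ∈ T_X has its triple inside [1,X] and, by TripleSign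
(product of three signs = +1), a vertex in
P_g; hence E = |T_X| ≤ Σ_{v∈P_g} deg_X(v) ≤ |P_g|^{1/2} (Σ_v deg_X(v)²)^{1/2} (Finset
Cauchy–Schwarz), so |P_g| ≥ (cX)²/(C X log X) =
(c²/C)·X/log X for X ≥ max(X₀, 2), with constants independent of g.

Rationale: WHY THIS LINE. Mechanism: one line of Gaussian arithmetic turns every divisor of n²+1 into an exact
three-term sign law, and COUNTING the certificates
(Σ_{d≤D} ρ(d) ~ (3/2π)D via primitive lattice points; degrees = divisors of v²+1 in multiplicative
windows around v) converts Chowla-type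
sign questions along an irreducible quadratic — where sieves see nothing (Teravainen2024 p.7:
"requires bypassing the parity problem") —
into divisor-in-interval statistics of n²+1 (Hooley1964, Tenenbaum1990 = doi:10.1007/BF01234418,
NairTenenbaum1998, Ford2008 =
doi:10.4007/annals.2008.168.367) plus one λ-specific input (Pell). Imported areas: arithmetic of
ℤ[i] / Gauss composition of forms of
discriminant −4; extremal combinatorics of 3-uniform hypergraphs (transversal ≥ E²/Σdeg²); the
Hall–Tenenbaum–Ford theory of divisors in
intervals. Prior state of the art on the −1/+1 sides: qualitative (BorweinChoiGanguli2013 Thm 2.4;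
Teravainen2024 Thm 2.3; Srinivasan2022 for
x²+d only, its p.2 stating the method fails for general ax²+bx+c). What no prior route does:
PolynomialMobius/UnimodularColumns/QuadraticRoots/
SelbergDelange all attack mean-zero or prime-count statements at n²+1; this route lands the first
unconditional parity-sensitive theorems
along n²+1 (one bit, g-uniform on the + side), gives refuters an exact invariant every model of
λ(n²+1) must satisfy (s(ν)s(ν+m)s(ν+m′) = 1
per SL₂ matrix), and isolates as cruxes the three places where more than certificates is needed.

RANKED CRUXES. #0 OneBitChowlaQuadratic (target) — X = P ∧ M ∧ Q of § Thesis: (P) g-uniform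
plus-floor c·X/log X along n²+1 for every completely multiplicative ±1-valued g; (M) power growth
X^c of #{n ≤ X : λ(n²+1) = −1}; (Q) λ(n²+bn+c) = −1 infinitely often whenever b²−4c is not a square.
(why it might fail: (P) inherits BalancedPairMoment's log-power; (M) and (Q) are open parity
statements along quadratics (Teravainen2024 §3.4) for which the route's own engine reaches only
exp((log X)^{o(1)}) resp. needs a seed per polynomial.) [Teravainen2024, BorweinChoiGanguli2013,
arXiv:2104.15004, NairTenenbaum1998]
#2 MinusPowerGrowth (crux) — there are c > 0 and X₀ with #{1 ≤ n ≤ X : λ(n²+1) = −1} ≥ X^c for all X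
≥ X₀ (card H5(b)). The −1 side is λ-specific (for general g it can be empty); the route's line of
attack is the composition tree: a −1 at n forces ≥ τ(n²+1)/2 further −1's in (n, n+n²+1] (support
MinusBranching), seeded by the Pell family n²+1 = 2y² (support MinusPellLog) and enriched by
primitive divisors of Pell numbers; HL-E would give X/log X (prime values have λ = −1). [deps:
MinusBranching, MinusPellLog] [difficulty: open-problem] (why it might fail: Any power bound for
#{Ω(n²+1) odd} is parity-sensitive on a thin set (c = 1/2, FordMaynard2024PrimeSieves §2.4): sieves
give P₂ (Iwaniec) never parity; Pell × tree × Carmichael stops at exp((log X)^{0.69/logloglog X});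
descendants jump to scale n² and may merge.) [Teravainen2024, BorweinChoiGanguli2013,
arXiv:2104.15004, FordMaynard2024PrimeSieves, Literature.Barriers.Parity.SelbergParityBarrier,
Literature.NumberTheory.Sieve.IwaniecAlmostPrimes]
#3 BalancedPairMoment (crux) — second moment of certificate degrees: with T_X = {(ν,d) : 1 ≤ ν, d ∣
ν²+1, ν < d, ν+d ≤ X} and deg_X(v) = #{(ν,d) ∈ T_X : v ∈ {ν, ν+(ν²+1)/d, ν+d}}, Σ_{v ≤ X} deg_X(v)²
≤ C·X·log X for all X ≥ 2 (card H5(a): the true order; degrees are divisor counts of v²+1 in the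
windows [v²/X, v] and (v/2, v), and pairs of such divisors sharing a Gaussian factor g contribute
Σ_{N(g)≤X} 1/N(g) ≍ log X). With TripleCount and TripleSign it yields (P) by Cauchy–Schwarz: |P| ≥
E²/Σdeg². [deps: TripleCount] [difficulty: L] (why it might fail: Numerically S2/(X log X) =
0.565→0.529 for X = 10⁴→4·10⁶ (kit j000162), but pairs (k₁,k₂) have lcm up to X² — beyond every
level of distribution — so a proof needs Tenenbaum1990/NairTenenbaum1998 window-divisor technology
along n²+1 and may lose a log-power (then restate).) [doi:10.1007/BF01234418, NairTenenbaum1998,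
Henriot2012, doi:10.4007/annals.2008.168.367, HallTenenbaum1988, Hooley1964, Toth2000,
DukeFriedlanderIwaniec1995]
#4 MinusEveryQuadratic (crux) — for all integers b, c with b²−4c not a square (i.e. X²+bX+c
irreducible), λ(n²+bn+c) = −1 for infinitely many n ≥ 0 (values ≤ 0 count as λ(0) = 0). By the k = 1
composition law one −1 beyond N_f forces infinitely many (BorweinChoiGanguli2013), so the content is
a UNIFORM seed; b even is Srinivasan2022 (x²+d, Teräväinen's Problem 3.1), b odd is the open case
(card H5(c)). [deps: CompositionLaw] [difficulty: M] (why it might fail: Srinivasan's genus+Pell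
construction is stated not to extend past x²+d (arXiv:2104.15004 p.2: the constraint X ≡ b mod 2a on
Pell solutions); no uniform seed is known, and a discriminant whose unit/genus structure keeps every
Pell orbit in the wrong parity class would break the method.) [arXiv:2104.15004,
BorweinChoiGanguli2013, Teravainen2024, Chowla1965]
#9 CompositionLaw (support) — for all integers n, k, k′, b, c with k·k′ = n²+bn+c: f(n+k)·f(n+k′) =
f(n)·(2n+k+k′+b)² and f(n)·f(n+k) = k²·f(n+k′), where f = X²+bX+c (card H1; ring identity given the
hypothesis — checked by `linear_combination` in the planner's Sketch.lean). [difficulty: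
provable-now] [BorweinChoiGanguli2013]
#9 TripleSign (support) — for every g : ℕ → ℤ completely multiplicative on positive integers with
values ±1, and all n, k, k′ ∈ ℕ with k·k′ = n²+1: g(n²+1)·g((n+k)²+1)·g((n+k′)²+1) = 1 (since
(n+k)²+1 = k(2n+k+k′), (n+k′)²+1 = k′(2n+k+k′)). The refuter tool: every model of λ(n²+1) must be a
codeword of these relations. [difficulty: provable-now] [BorweinChoiGanguli2013, Teravainen2024]
#9 TripleCount (support) — linearly many certificates inside [1,X]: #{(ν,d) : 1 ≤ ν ≤ X, 1 ≤ d ≤ X,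
d ∣ ν²+1, ν < d, ν+d ≤ X} ≥ c·X for X ≥ X₀ (each pair is the triple {ν, ν+(ν²+1)/d, ν+d} ⊂ [1,X] of
three distinct points; Σ_{2≤d≤X/2} ρ(d) ≥ (number of primitive (a,b) with a²+b² ≤ X/2)/4 ≫ X;
asymptotically E(X) ~ (3 log 2/2π)X = 0.331X). [difficulty: M] [Hooley1964, BorweinChoiGanguli2013]
#9 PlusFloor (support) — T1 in its elementary form, uniform in g: for every ε > 0 there is X₀ such
that for EVERY completely multiplicative ±1-valued g and all X ≥ X₀, #{n ≤ X : g(n²+1) = +1} ≥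
X^{1−ε}. Proof: every triple contains a +1 (TripleSign); deg_X(v) ≤ 3τ(v²+1) ≤ 3C_δ(X²+1)^δ
(Literature.NumberTheory.Sieve.exists_card_divisors_le_mul_rpow); Cauchy–Schwarz with TripleCount.
[difficulty: L] [Literature.NumberTheory.Sieve.exists_card_divisors_le_mul_rpow, NairTenenbaum1998,
Teravainen2024]
#9 GapFiveY (support) — T2: there is Y₀ such that for every completely multiplicative ±1-valued g
and every Y ≥ Y₀ some n ∈ [Y, 5Y] has g(n²+1) = +1. Proof: pick m with d = m²+1 ∈ [2Y, 2.5Y]; ν =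
m²−m+1 is the large root of ν² ≡ −1 (mod d); the triple {ν, ν+(ν²+1)/d, ν+d} lies in [d−√d, 2d] ⊂
[Y, 5Y]; apply TripleSign. [difficulty: M] [BorweinChoiGanguli2013, Hooley1964]
#9 MinusPellLog (support) — T3 in its elementary form: #{n ≤ X : λ(n²+1) = −1} ≥ c·log X for X ≥ X₀
(n_j² + 1 = 2y_j² along (n,y) ↦ (3n+4y, 2n+3y) from (1,1); λ(2y²) = −1; n_j ≤ 7^j). [difficulty: M]
[BorweinChoiGanguli2013, Teravainen2024, arXiv:2104.15004]
#9 MinusBranching (support) — the composition tree on the −1 side: for every completely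
multiplicative ±1-valued g and n ≥ 1 with g(n²+1) = −1, τ(n²+1) ≤ 2·#{m ∈ (n, n+n²+1] : g(m²+1) =
−1} (for each divisor pair {k, (n²+1)/k} exactly one of n+k, n+(n²+1)/k carries −1 by TripleSign;
the points n+k are distinct). [difficulty: provable-now] [BorweinChoiGanguli2013]

TWO-LAYER PLAN. Foreseen glued splits (none filed now): BalancedPairMoment ⇐ SmallCoprimeParts
(pairs of balanced Gaussian divisors g·a, g·b of v+i with
N(ab) ≤ X: Type-I count in ℤ[i]) → LargeCoprimeParts (N(ab) > X: switch to the cofactor h of norm ≤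
√X and bound window-divisor sums of the
linear Gaussian form (v+i)/h over n ≡ ν_h (mod N(h)) by Nair–Tenenbaum/Henriot) →
BalancedPairMoment. MinusPowerGrowth ⇐ MinusSuperPolylog
(Pell seeds × MinusBranching × Carmichael primitive divisors: ≥ exp((log X)^{c/logloglog X})) →
NonMergingDescendants (distinct −1's along
k ≠ 1 branches below X) → MinusPowerGrowth. MinusEveryQuadratic ⇐ SeedExists (∀ b,c ∃ n ≥ N_{b,c}
with Ω(n²+bn+c) odd, uniformly) →
ChainFromSeed (k = 1 law: one −1 ⇒ infinitely many; provable) → MinusEveryQuadratic.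

KILL CRITERIA. BalancedPairMoment refuted (Σdeg² ≫ X(log X)^{1+δ}, numerically via kit j000162 or by
a divisor-clustering argument) ⇒ PIVOT: restate with
the measured exponent (the CS floor becomes X/(log X)^{1+δ}); do not close. MinusPowerGrowth or
MinusEveryQuadratic refuted (an eventual
sign λ(f(n)) = +1 along an irreducible quadratic) refutes Chowla1965 for that f and PolyChowla
(stmt-Parity-0872) ⇒ close
`refuted:<Decl>` and flag route PolynomialMobius. CompositionLaw/TripleSign are ring identities
(checked in Sketch.lean): a refutation means
my transcription is wrong ⇒ re-file. Mooted: the + side by a proof of CLAIM+ (companion card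
parity-code-claim-plus); (M) by HL-E with any
lower bound ≫ X^c for prime values; the whole route by PolyChowla at n²+1.

NOT DECOMPOSED YET. The (log X)³ rung of T1 (needs Σ_{n≤x} τ(n²+1)² ≪ x log³x, NairTenenbaum1998 — a
vendorable fact, skipped in favour of the sharp crux);
the Ford–Tenenbaum wall (#{v ≤ X : deg_X(v) > 0} = o(X): certificates alone never give density —
negative knowledge shared with
parity-code-claim-plus, whose CLAIM+ is deliberately NOT an item here); the sharp gap [Y,(1+ε)Y]
(equidistribution of ν/d: Hooley1964,
DukeFriedlanderIwaniec1995, Toth2000); T1 for all monic quadratics (Σ_d ρ_f(d) ≫ X through the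
reduced forms of disc f); the super-polylog
−1 rung (Carmichael 1913 primitive divisors, absent from Mathlib); non-monic aX²+bX+c; 𝔽_q[u]
transcription; degree ≥ 3 (no certificates
expected — companion question); constants (c in (P) vs the companion's measured 0.067X disjoint
triples at 8·10⁵).

CHEAPEST FALSIFIER. kit job j000162 (certdeg.py in this folder; done, 43 s): for X = 10⁴, 3·10⁴,
10⁵, 3·10⁵, 10⁶, 2·10⁶, 4·10⁶ it measured E/X = 0.3306, 0.3311,
0.3306, 0.3316, 0.3309, 0.3310, 0.3308 (prediction 3 log 2/2π = 0.3310); S2/(X log X) = 0.565,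
0.557, 0.547, 0.541, 0.535, 0.531, 0.529
(slowly DEcreasing, i.e. S2 = C·X log X + O(X) with C ≈ 0.5 — while S2/(X log²X) falls 0.061 →
0.035); CS floor E²/S2 = 0.194, 0.197, 0.200,
0.203, 0.205, 0.206, 0.207 × X/log X; covered/X = 0.346 → 0.294 and greedy-disjoint/X = 0.060 →
0.051 (the Ford–Tenenbaum thinning). So the
cheapest falsifier of the line — S2/(X log X) growing like a power of log X — did NOT fire up to
4·10⁶; a refuter should push to 10⁸ with a
compiled root sieve and fit S2 = C X log X + C′X. If it ever grows, BalancedPairMoment is mis-stated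
(pivot per Kill criteria).

NUMBERS. E(X)/X → 3 log 2/(2π) = 0.3310 (measured 0.3306–0.3316 for 10⁴ ≤ X ≤ 4·10⁶, kit j000162;
card: 0.3315 at 8·10⁵). S2/(X log X) ≈ 0.53 at
4·10⁶, drifting down (fit C ≈ 0.49 plus C′X); certified plus-floor constant from CS ≈ 0.207·X/log X
at 4·10⁶ (vs the true +-density 1/2 for λ
and the companion's worst-case brackets 0.067 ≤ 1−c₋* ≤ 0.134 at 10⁵–10⁶). Covered vertices 0.294X
at 4·10⁶, decaying like Ford's law
(δ = 1 − (1+log log 2)/log 2 = 0.08607, doi:10.4007/annals.2008.168.367). Pell: n_j ≤ 7^j ⇒ ≥ log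
X/log 7 minus signs; composition tree +
Carmichael: exp((log X)^{(log 2+o(1))/logloglog X}). Gap window [Y,5Y] from d = m²+1 ∈ [2Y,2.5Y].
Items at open: 12 (1 target, 3 cruxes,
7 supports, 1 assembly).

DEFINITION REQUESTS. None: every statement is over Mathlib (ArithmeticFunction.liouville,
Nat.divisors, Finset.filter/card, Real.log, IsSquare). Facts that
would sharpen supports if vendored later (not requested now): NairTenenbaum1998 short-sum bound for
τ² along n²+1; Carmichael 1913 /
Zsigmondy primitive divisors for the Pell sequence.

Novelty: Searches (2026-08-15): `lit citing arxiv:1109.3107` (6: Teravainen2024, arXiv:2202.08767,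
arXiv:2111.01012, arXiv:2104.15004, Ganguli
thesis, arXiv:1202.0471) and `lit citing arxiv:2104.15004` (3: Teravainen2024, arXiv:2211.09736 —
abstract read, sign patterns of λ(n),
unrelated); `lit frontier Parity --since 2021` (30 rows, none on λ at polynomial arguments); `lit
galaxy search "Liouville function" --star
all` (16 rows, noise) and `"Erdős et Schinzel" --star all` (6 rows → Tenenbaum's Erdős-centennial
survey galaxy-pdf-7577578164621247660
read pp.14–15, 31–33: refs [38] Ford2008, [48] Henriot2012, [57] NairTenenbaum1998, [71]
Tenenbaum1990); `lit read arXiv:2010.07924`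
pp.5, 7 (Prop. 2.11, §3.4 Problems 3.1–3.2, BCG summary) and `lit read arXiv:2104.15004` pp.2–3
(Theorem 3; remark that the method fails
for ax²+bx+c; Lemmas 6–9); `lean search` for liouville / divisor bound / Hooley / DFI–Tóth decls;
`lit search` ×3 → searchd rc 75 all
session (flagged; the card's triage ran zbMATH ×4, arXiv ×2, Crossref the same day). Nearest prior
art found: BorweinChoiGanguli2013 =
doi:10.4153/cmb-2011-166-9 (k = 1 identity; one sign change ⇒ infinitely many, qualitative);
Srinivasan2022 = doi:10.1090/proc/15939 =
arXiv:2104.15004 (x²+d via genera + Pell; explicitly not general quadratics); Teravainen2024 =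
arXiv:2010.07924 (Thm 2.3 both signs i.o.
for ∏((x+h)²+1), Thm 2.10 pretentious g, Problem 3.1); divisor-in-interval law Tenenbaum1990 /
Ford2008. Delta: the general-k law used
QUANTITA  [refs: 10.4153/cmb-2011-166-9, 10.1090/proc/15939, 1109.3107, 2202.08767, 2111.01012, 2104.15004, 1202.0471, 2211.09736, 2010.07924, arxiv:1109.3107, arxiv:2104.15004, doi:10.4153/cmb-2011-166-9, doi:10.1090/proc/15939, Teravainen2024, Henriot2012, NairTenenbaum1998]

Barriers (technique_class: algebraic-identity gauss-composition sign-certificates): - technique_class: algebraic-identity gauss-composition sign-certificates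
- Literature.Barriers.Parity.SelbergParityBarrier: EVADED for (P) and all supports — they rest on an
exact multiplicative identity among three VALUES f(ν), f(ν+k), f(ν+k′), uniform over completely
multiplicative g, not on divisibility statistics of a sifted sequence (Selberg's 1±λ twins are not
of the form g∘f); NOT evaded for MinusPowerGrowth: a power lower bound for odd Ω(n²+1) beyond
algebraic certificates is parity-sensitive — the bet is λ-specific algebra (Pell × composition tree
× primitive divisors) or an imported parity-breaking input, and the crux is ranked 2 for that
reason.
- Literature.Barriers.Parity.FordMaynardLowLevel: no Type-I/II information is used; {n²+1} is a thin
set (c = 1/2, no bilinear range) and the route shows what that verdict does not cover — sign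
information from algebraic relations inside the thin set; BalancedPairMoment is an UPPER bound for
an unsigned divisor-pair count, where level-of-distribution losses cost constants/logs, not parity.
- Literature.Barriers.Parity.FunctionFieldMobiusBias: the composition law and TripleSign hold
verbatim over 𝔽_q[u], and Conrad–Conrad–Gross bias (one sign on a periodic set, never "all −1") is
consistent with a + floor; it warns that the −1-side cruxes (M), (Q) are FALSE for some inseparable
f over 𝔽_q[u], so their proofs must use characteristic-0 / λ-specific input (Pell units), as the
route does.
- Literature.Barriers.Parity.Logarithmi

Novelty grade: new-combination — REVIEW 2026-08-15 (route already CLOSED retired by operator, D-0027 §2.1 — declared THEOREM+PROBE, X ⊬ BatemanHorn; note for a re-file from card composition-triples-one-bit-chowla). new-combination (concur w/ triage-15). TECHNICAL read of Target OneBitChowlaQuadratic = P∧M∧Q (stmt-7862): (P) ∃c,X₀ ∀ (refuter refuter-rreview-route-SmoothPoincare4-Sy-1eea1645-0, 2026-08-15T13:59:34Z; prior: arXiv:1109.3107 Thm 2.4 (BCG 2013, k=1 law, qualitative), arXiv:2010.07924 Thm 2.3, §3.4 (Teravainen AJM 2024), arXiv:2104.15004 (Srinivasan PAMS 2022, x^2+d),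 NairTenenbaum1998 Acta Math. 180, Todd 1949 AMM 56 / Lehmer 1938 (arccot relations = composition law))

History (route lifecycle, newest last):
- 2026-08-15T13:49:26Z · CLOSED retired — not-a-thesis: assembly does not conclude the sub-problem Statement (operator:999:1257524)

sub-problem: BatemanHorn · status: closed(retired) · opened planner-plancard-Parity-BatemanHorn-compositi-e4979425-0 2026-08-15T12:19:27Z · rev 0 · ledger route-Parity-CompositionCertificates
GENERATED by the gate from the ledger (D-0016/17). Provers cite these decls: `theorem foo : Summit.Parity.BatemanHorn.Theses.CompositionCertificates.<Decl> := …` in Summits/Parity/BatemanHorn/Theorems/<Name>.lean.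
-/

namespace Summit.Parity.BatemanHorn.Theses.CompositionCertificates

open scoped BigOperators Topology Manifold Classical MeasureTheory ProbabilityTheory Matrix InnerProductSpace ComplexConjugate ContinuousMap
open Filter Set Function TopologicalSpace MeasureTheory

attribute [summit_statement] _root_.BatemanHorn

/-- item stmt-Parity-7862 · target · rank 0 · closed · moot by None · by planner
why it might fail: (P) inherits BalancedPairMoment's log-power; (M) and (Q) are open parity statements along quadratics (Teravainen2024 §3.4) for which the route's own engine reaches only exp((log X)^{o(1)}) resp. needs a seed per polynomial.
sources: Teravainen2024, BorweinChoiGanguli2013, arXiv:2104.15004, NairTenenbaum1998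
[target] X = P ∧ M ∧ Q of § Thesis: (P) g-uniform plus-floor c·X/log X along n²+1 for every
completely multiplicative ±1-valued g; (M) power growth X^c of #{n ≤ X : λ(n²+1) = −1}; (Q)
λ(n²+bn+c) = −1 infinitely often whenever b²−4c is not a square. -/
@[route_item "route-Parity-CompositionCertificates"]
def OneBitChowlaQuadratic : Prop :=
  (∃ c : ℝ, 0 < c ∧ ∃ X₀ : ℕ, ∀ g : ℕ → ℤ, (∀ m n : ℕ, 0 < m → 0 < n → g (m * n) = g m * g n) → (∀ n : ℕ, 0 < n → (g n = 1 ∨ g n = -1)) → ∀ X : ℕ, X₀ ≤ X → c * (X : ℝ) / Real.log (X : ℝ) ≤ (((Finset.Icc 1 X).filter (fun n : ℕ => g (n ^ 2 + 1) = 1)).card : ℝ)) ∧ (∃ c : ℝ, 0 < c ∧ ∃ X₀ : ℕ, ∀ X : ℕ, X₀ ≤ X → (X : ℝ) ^ c ≤ (((Finset.Icc 1 X).filter (fun n : ℕ => ArithmeticFunction.liouville (n ^ 2 + 1) = -1)).card : ℝ)) ∧ (∀ b c : ℤ, ¬ IsSquare (b ^ 2 - 4 * c) → Set.Infinite {n :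 ℕ | ArithmeticFunction.liouville (((n : ℤ) ^ 2 + b * n + c).toNat) = -1})

/-- item stmt-Parity-7863 · crux · rank 2 · closed · moot by None · by planner
why it might fail: Any power bound for #{Ω(n²+1) odd} is parity-sensitive on a thin set (c = 1/2, FordMaynard2024PrimeSieves §2.4): sieves give P₂ (Iwaniec) never parity; Pell × tree × Carmichael stops at exp((log X)^{0.69/logloglog X}); descendants jump to scale n² and may merge.
sources: Teravainen2024, BorweinChoiGanguli2013, arXiv:2104.15004, FordMaynard2024PrimeSieves, Literature.Barriers.Parity.SelbergParityBarrier, Literature.NumberTheory.Sieve.IwaniecAlmostPrimes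
[crux] there are c > 0 and X₀ with #{1 ≤ n ≤ X : λ(n²+1) = −1} ≥ X^c for all X ≥ X₀ (card H5(b)).
The −1 side is λ-specific (for general g it can be empty); the route's line of attack is the
composition tree: a −1 at n forces ≥ τ(n²+1)/2 further −1's in (n, n+n²+1] (support MinusBranching),
seeded by the Pell family n²+1 = 2y² (support MinusPellLog) and enriched by primitive divisors of
Pell numbers; HL-E would give X/log X (prime values have λ = −1). [deps: MinusBranching,
MinusPellLog] [difficulty: open-problem] -/
@[route_item "route-Parity-CompositionCertificates"]
def MinusPowerGrowth : Prop :=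
  ∃ c : ℝ, 0 < c ∧ ∃ X₀ : ℕ, ∀ X : ℕ, X₀ ≤ X → (X : ℝ) ^ c ≤ (((Finset.Icc 1 X).filter (fun n : ℕ => ArithmeticFunction.liouville (n ^ 2 + 1) = -1)).card : ℝ)

/-- item stmt-Parity-7864 · crux · rank 3 · closed · moot by None · by planner
why it might fail: Numerically S2/(X log X) = 0.565→0.529 for X = 10⁴→4·10⁶ (kit j000162), but pairs (k₁,k₂) have lcm up to X² — beyond every level of distribution — so a proof needs Tenenbaum1990/NairTenenbaum1998 window-divisor technology along n²+1 and may lose a log-power (then restate).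
sources: doi:10.1007/BF01234418, NairTenenbaum1998, Henriot2012, doi:10.4007/annals.2008.168.367, HallTenenbaum1988, Hooley1964
[crux] second moment of certificate degrees: with T_X = {(ν,d) : 1 ≤ ν, d ∣ ν²+1, ν < d, ν+d ≤ X}
and deg_X(v) = #{(ν,d) ∈ T_X : v ∈ {ν, ν+(ν²+1)/d, ν+d}}, Σ_{v ≤ X} deg_X(v)² ≤ C·X·log X for all X
≥ 2 (card H5(a): the true order; degrees are divisor counts of v²+1 in the windows [v²/X, v] and
(v/2, v), and pairs of such divisors sharing a Gaussian factor g contribute Σ_{N(g)≤X} 1/N(g) ≍ log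
X). With TripleCount and TripleSign it yields (P) by Cauchy–Schwarz: |P| ≥ E²/Σdeg². [deps:
TripleCount] [difficulty: L] -/
@[route_item "route-Parity-CompositionCertificates"]
def BalancedPairMoment : Prop :=
  ∃ C : ℝ, ∀ X : ℕ, 2 ≤ X → (∑ v ∈ Finset.Icc 1 X, ((((Finset.Icc 1 X) ×ˢ (Finset.Icc 1 X)).filter (fun p : ℕ × ℕ => p.2 ∣ p.1 ^ 2 + 1 ∧ p.1 < p.2 ∧ p.1 + p.2 ≤ X ∧ (v = p.1 ∨ v = p.1 + (p.1 ^ 2 + 1) / p.2 ∨ v = p.1 + p.2))).card : ℝ) ^ 2) ≤ C * (X : ℝ) * Real.log (X : ℝ)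

/-- item stmt-Parity-7865 · crux · rank 4 · closed · moot by None · by planner
why it might fail: Srinivasan's genus+Pell construction is stated not to extend past x²+d (arXiv:2104.15004 p.2: the constraint X ≡ b mod 2a on Pell solutions); no uniform seed is known, and a discriminant whose unit/genus structure keeps every Pell orbit in the wrong parity class would break the method.
sources: arXiv:2104.15004, BorweinChoiGanguli2013, Teravainen2024, Chowla1965
[crux] for all integers b, c with b²−4c not a square (i.e. X²+bX+c irreducible), λ(n²+bn+c) = −1 for
infinitely many n ≥ 0 (values ≤ 0 count as λ(0) = 0). By the k = 1 composition law one −1 beyond N_f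
forces infinitely many (BorweinChoiGanguli2013), so the content is a UNIFORM seed; b even is
Srinivasan2022 (x²+d, Teräväinen's Problem 3.1), b odd is the open case (card H5(c)). [deps:
CompositionLaw] [difficulty: M] -/
@[route_item "route-Parity-CompositionCertificates"]
def MinusEveryQuadratic : Prop :=
  ∀ b c : ℤ, ¬ IsSquare (b ^ 2 - 4 * c) → Set.Infinite {n : ℕ | ArithmeticFunction.liouville (((n : ℤ) ^ 2 + b * n + c).toNat) = -1}

/-- item stmt-Parity-7866 · support · rank 9 · closed · moot by None · by planner
sources: BorweinChoiGanguli2013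
[support] for all integers n, k, k′, b, c with k·k′ = n²+bn+c: f(n+k)·f(n+k′) = f(n)·(2n+k+k′+b)²
and f(n)·f(n+k) = k²·f(n+k′), where f = X²+bX+c (card H1; ring identity given the hypothesis —
checked by `linear_combination` in the planner's Sketch.lean). [difficulty: provable-now] -/
@[route_item "route-Parity-CompositionCertificates"]
def CompositionLaw : Prop :=
  ∀ n k k' b c : ℤ, k * k' = n ^ 2 + b * n + c → ((n + k) ^ 2 + b * (n + k) + c) * ((n + k') ^ 2 + b * (n + k') + c) = (n ^ 2 + b * n + c) * (2 * n + k + k' + b) ^ 2 ∧ (n ^ 2 + b * n + c) * ((n + k) ^ 2 + b * (n + k) + c) = k ^ 2 * ((n + k') ^ 2 + b * (n + k') + c)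

/-- item stmt-Parity-7867 · support · rank 9 · closed · moot by None · by planner
sources: BorweinChoiGanguli2013, Teravainen2024
[support] for every g : ℕ → ℤ completely multiplicative on positive integers with values ±1, and all
n, k, k′ ∈ ℕ with k·k′ = n²+1: g(n²+1)·g((n+k)²+1)·g((n+k′)²+1) = 1 (since (n+k)²+1 = k(2n+k+k′),
(n+k′)²+1 = k′(2n+k+k′)). The refuter tool: every model of λ(n²+1) must be a codeword of these
relations. [difficulty: provable-now] -/
@[route_item "route-Parity-CompositionCertificates"]
def TripleSign : Prop :=
  ∀ g : ℕ → ℤ, (∀ m n : ℕ, 0 < m → 0 < n → g (m * n) = g m * g n) → (∀ n : ℕ, 0 < n → (g n = 1 ∨ g n = -1)) → ∀ n k k' : ℕ, k * k' = n ^ 2 + 1 → g (n ^ 2 + 1) * g ((n + k) ^ 2 + 1) * g ((n + k') ^ 2 + 1) = 1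

/-- item stmt-Parity-7868 · support · rank 9 · closed · moot by None · by planner
sources: Hooley1964, BorweinChoiGanguli2013
[support] linearly many certificates inside [1,X]: #{(ν,d) : 1 ≤ ν ≤ X, 1 ≤ d ≤ X, d ∣ ν²+1, ν < d,
ν+d ≤ X} ≥ c·X for X ≥ X₀ (each pair is the triple {ν, ν+(ν²+1)/d, ν+d} ⊂ [1,X] of three distinct
points; Σ_{2≤d≤X/2} ρ(d) ≥ (number of primitive (a,b) with a²+b² ≤ X/2)/4 ≫ X; asymptotically E(X) ~
(3 log 2/2π)X = 0.331X). [difficulty: M] -/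
@[route_item "route-Parity-CompositionCertificates"]
def TripleCount : Prop :=
  ∃ c : ℝ, 0 < c ∧ ∃ X₀ : ℕ, ∀ X : ℕ, X₀ ≤ X → c * (X : ℝ) ≤ ((((Finset.Icc 1 X) ×ˢ (Finset.Icc 1 X)).filter (fun p : ℕ × ℕ => p.2 ∣ p.1 ^ 2 + 1 ∧ p.1 < p.2 ∧ p.1 + p.2 ≤ X)).card : ℝ)

/-- item stmt-Parity-7869 · support · rank 9 · closed · moot by None · by planner
sources: Literature.NumberTheory.Sieve.exists_card_divisors_le_mul_rpow, NairTenenbaum1998, Teravainen2024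
[support] T1 in its elementary form, uniform in g: for every ε > 0 there is X₀ such that for EVERY
completely multiplicative ±1-valued g and all X ≥ X₀, #{n ≤ X : g(n²+1) = +1} ≥ X^{1−ε}. Proof:
every triple contains a +1 (TripleSign); deg_X(v) ≤ 3τ(v²+1) ≤ 3C_δ(X²+1)^δ
(Literature.NumberTheory.Sieve.exists_card_divisors_le_mul_rpow); Cauchy–Schwarz with TripleCount.
[difficulty: L] -/
@[route_item "route-Parity-CompositionCertificates"]
def PlusFloor : Prop :=
  ∀ ε : ℝ, 0 < ε → ∃ X₀ : ℕ, ∀ g : ℕ → ℤ, (∀ m n : ℕ, 0 < m → 0 < n → g (m * n) = g m * g n) → (∀ n : ℕ, 0 < n → (g n = 1 ∨ g n = -1)) → ∀ X : ℕ, X₀ ≤ X → (X : ℝ) ^ (1 - ε) ≤ (((Finset.Icc 1 X).filter (fun n : ℕ => g (n ^ 2 + 1) = 1)).card : ℝ)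

/-- item stmt-Parity-7870 · support · rank 9 · closed · moot by None · by planner
sources: BorweinChoiGanguli2013, Hooley1964
[support] T2: there is Y₀ such that for every completely multiplicative ±1-valued g and every Y ≥ Y₀
some n ∈ [Y, 5Y] has g(n²+1) = +1. Proof: pick m with d = m²+1 ∈ [2Y, 2.5Y]; ν = m²−m+1 is the large
root of ν² ≡ −1 (mod d); the triple {ν, ν+(ν²+1)/d, ν+d} lies in [d−√d, 2d] ⊂ [Y, 5Y]; apply
TripleSign. [difficulty: M] -/
@[route_item "route-Parity-CompositionCertificates"]
def GapFiveY : Prop :=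
  ∃ Y₀ : ℕ, ∀ g : ℕ → ℤ, (∀ m n : ℕ, 0 < m → 0 < n → g (m * n) = g m * g n) → (∀ n : ℕ, 0 < n → (g n = 1 ∨ g n = -1)) → ∀ Y : ℕ, Y₀ ≤ Y → ∃ n : ℕ, Y ≤ n ∧ n ≤ 5 * Y ∧ g (n ^ 2 + 1) = 1

/-- item stmt-Parity-7871 · support · rank 9 · closed · moot by None · by planner
sources: BorweinChoiGanguli2013, Teravainen2024, arXiv:2104.15004
[support] T3 in its elementary form: #{n ≤ X : λ(n²+1) = −1} ≥ c·log X for X ≥ X₀ (n_j² + 1 = 2y_j²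
along (n,y) ↦ (3n+4y, 2n+3y) from (1,1); λ(2y²) = −1; n_j ≤ 7^j). [difficulty: M] -/
@[route_item "route-Parity-CompositionCertificates"]
def MinusPellLog : Prop :=
  ∃ c : ℝ, 0 < c ∧ ∃ X₀ : ℕ, ∀ X : ℕ, X₀ ≤ X → c * Real.log (X : ℝ) ≤ (((Finset.Icc 1 X).filter (fun n : ℕ => ArithmeticFunction.liouville (n ^ 2 + 1) = -1)).card : ℝ)

/-- item stmt-Parity-7872 · support · rank 9 · closed · moot by None · by planner
sources: BorweinChoiGanguli2013
[support] the composition tree on the −1 side: for every completely multiplicative ±1-valued g and n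
≥ 1 with g(n²+1) = −1, τ(n²+1) ≤ 2·#{m ∈ (n, n+n²+1] : g(m²+1) = −1} (for each divisor pair {k,
(n²+1)/k} exactly one of n+k, n+(n²+1)/k carries −1 by TripleSign; the points n+k are distinct).
[difficulty: provable-now] -/
@[route_item "route-Parity-CompositionCertificates"]
def MinusBranching : Prop :=
  ∀ g : ℕ → ℤ, (∀ m n : ℕ, 0 < m → 0 < n → g (m * n) = g m * g n) → (∀ n : ℕ, 0 < n → (g n = 1 ∨ g n = -1)) → ∀ n : ℕ, 1 ≤ n → g (n ^ 2 + 1) = -1 → (n ^ 2 + 1).divisors.card ≤ 2 * ((Finset.Ioc n (n + (n ^ 2 + 1))).filter (fun m : ℕ => g (m ^ 2 + 1) = -1)).card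

/-- item stmt-Parity-7873 · assembly · rank 1 · closed · moot by None · by planner
sources: BorweinChoiGanguli2013, NairTenenbaum1998
[assembly] BalancedPairMoment → TripleCount → TripleSign → MinusPowerGrowth → MinusEveryQuadratic →
OneBitChowlaQuadratic. -/
@[route_item "route-Parity-CompositionCertificates"]
def Assembly : Prop :=
  BalancedPairMoment → TripleCount → TripleSign → MinusPowerGrowth → MinusEveryQuadratic → OneBitChowlaQuadratic

end Summit.Parity.BatemanHorn.Theses.CompositionCertificates
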